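import Mathlib
import HarnessLib

/-!
# The dressing CLAMP: from `|f − 1| ≤ κ·d² + ε` (quadratic up to a `u`-independent slack) to a weight `W̃` with `|W̃² − 1| ≤ κ'·d²` EXACTLY and `|W̃² − f| ≤ ε`
# (route `FlatTubeReduction`, crux K1 `NearFlatRatioLaw` stmt-QuantumFields-24720; seat `ym-line-ftr-p1` g13; rate twin «ratepack-v3 / frozen fibres»; R2b1 RECORD rung — no summit
# statement is proved here)

WHY (memo `Cruxes/NearFlatRatioLaw/Lines/ratepack-v3-frozen-g12.md` §6).  The hand-off object `RateTube.AnalyticRatePotInput` asks for the dressed weight POINTWISE: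
`hWsq : |W β u² − 1| ≤ κW·orbitDist u²` (essential downstream: the (EM) eigen-moments turn `κW·d²` into `O(λ_b²)`).  The moment machine delivers the exact diagonal ratio
`f(u) = fpBOKernel(u,u)/(…)` only in the shape `|f − 1| ≤ κ·d² + ε_W(β)` (`…DiagonalRatioOfLevelBounds`: `ε_W` = differenced cubic junk after AM–GM + Gaussian tails, `ε_W ≪ λ_b²`
but independent of `u`).  Rather than re-plumbing five files of the g9–g12 chain, CLAMP: `W̃ = √(max(1 − κ'd², min(1 + κ'd², f)))` with `κ' ≥ κ` satisfies `hWsq` with `κ'`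
exactly, inherits measurability and every invariance of `f` and `d`, and differs from `f` by at most `ε` in the square — a slack that the (B-T) brick `hT` (where `W` meets the true
kernel) absorbs into its `κ = O(λ_b²)`.
* `clampSq` lemmas: ★ `abs_clampW_sq_sub_one_le` (`|W̃² − 1| ≤ κ'd²`), ★ `abs_clampW_sq_sub_le` (`|W̃² − f| ≤ ε` when `|f − 1| ≤ κd² + ε`, `0 ≤ ε`, `κ ≤ κ'`, `0 ≤ κ'`, `f ≥ 0`), `clampW_nonneg`,
  `clampW_le` (bounded by `√(1 + C)` if `f ≤ C`), `measurable_clampW`, `clampW_comp` (invariance transfer).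
HONEST FRAMING: elementary real analysis (no gauge theory); femto rung R2b1 (RECORD label); not infinite volume, not a gap, not Clay.  No named facts, no `sorry`; the `def clampW` is
a local real-analysis gadget (route-posited object of the rate twin), not a Literature notion.
-/

set_option autoImplicit false

noncomputable section

open MeasureTheory Real

namespace Summit.QuantumFields.YangMills.Theorems.FemtoTransferGap.RateTube

/-- **The clamped dressing**: `clampW κ f d a = √(max (1 − κ·d(a)²) (min (1 + κ·d(a)²) (f a)))`. [folklore] -/
def clampW {α : Type*} (κ : ℝ) (f d : α → ℝ) (a : α) : ℝ := Real.sqrt (max (1 - κ * d a ^ 2) (min (1 + κ * d a ^ 2) (f a)))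

variable {α : Type*}

/-- `0 ≤ clampW`. [folklore] -/
theorem clampW_nonneg (κ : ℝ) (f d : α → ℝ) (a : α) : 0 ≤ clampW κ f d a := Real.sqrt_nonneg _

/-- The square of the clamp is the clamped value when that is non-negative, else `0`. [folklore] -/
theorem clampW_sq (κ : ℝ) (f d : α → ℝ) (a : α) : clampW κ f d a ^ 2 = max 0 (max (1 - κ * d a ^ 2) (min (1 + κ * d a ^ 2) (f a))) := by
  unfold clampW
  by_cases h : 0 ≤ max (1 - κ * d a ^ 2) (min (1 + κ * d a ^ 2) (f a))
  · rw [Real.sq_sqrt h, max_eq_right h]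
  · have h' := not_le.mp h
    rw [Real.sqrt_eq_zero'.mpr h'.le, max_eq_left h'.le]; ring

/-- ★ **The clamp is quadratically two-sided, exactly**: `|clampW² − 1| ≤ κ·d²` (`κ ≥ 0`). [folklore] -/
theorem abs_clampW_sq_sub_one_le {κ : ℝ} (hκ : 0 ≤ κ) (f d : α → ℝ) (a : α) : |clampW κ f d a ^ 2 - 1| ≤ κ * d a ^ 2 := by
  rw [clampW_sq]
  have hk : 0 ≤ κ * d a ^ 2 := mul_nonneg hκ (sq_nonneg _)
  set c := max (1 - κ * d a ^ 2) (min (1 + κ * d a ^ 2) (f a)) with hc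
  have hc1 : 1 - κ * d a ^ 2 ≤ c := le_max_left _ _
  have hc2 : c ≤ 1 + κ * d a ^ 2 := max_le (by linarith) (min_le_left _ _)
  rw [abs_le]
  constructor
  · have : 1 - κ * d a ^ 2 ≤ max 0 c := hc1.trans (le_max_right _ _)
    linarith
  · have : max 0 c ≤ 1 + κ * d a ^ 2 := max_le (by linarith) hc2
    linarith

/-- ★ **The clamp moves `f` by at most the slack**: if `0 ≤ f a`, `|f a − 1| ≤ κ·d(a)² + ε` and `κ ≤ κ'`, then `|clampW κ' f d a² − f a| ≤ ε`. [folklore] -/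
theorem abs_clampW_sq_sub_le {κ κ' ε : ℝ} (hκκ : κ ≤ κ') (hκ' : 0 ≤ κ') (hε : 0 ≤ ε) {f d : α → ℝ} {a : α} (hf0 : 0 ≤ f a) (hf : |f a - 1| ≤ κ * d a ^ 2 + ε) :
    |clampW κ' f d a ^ 2 - f a| ≤ ε := by
  rw [clampW_sq]
  have hd : κ * d a ^ 2 ≤ κ' * d a ^ 2 := mul_le_mul_of_nonneg_right hκκ (sq_nonneg _)
  obtain ⟨hl, hu⟩ := abs_le.mp hf
  by_cases h2 : f a ≤ 1 + κ' * d a ^ 2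
  · by_cases h3 : 1 - κ' * d a ^ 2 ≤ f a
    · -- inside the window: the clamp is `f`
      rw [min_eq_right h2, max_eq_right h3, max_eq_right hf0, sub_self, abs_zero]; exact hε
    · -- below: clamp = 1 − κ'd² > f ≥ 0
      have h3' := not_le.mp h3
      rw [min_eq_right h2, max_eq_left h3'.le, max_eq_right (by linarith), abs_of_nonneg (by linarith)]
      linarith
  · -- above: clamp = 1 + κ'd²
    have h2' := not_le.mp h2
    have hk : 0 ≤ κ' * d a ^ 2 := mul_nonneg hκ' (sq_nonneg _)
    have h4 : 1 - κ' * d a ^ 2 ≤ 1 + κ' * d a ^ 2 := by linarith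
    rw [min_eq_left h2'.le, max_eq_right h4, max_eq_right (by linarith), abs_of_nonpos (by linarith)]
    linarith

/-- `clampW² ≤ max 1 (f a)` and hence `clampW ≤ √(1 + C)` when `0 ≤ f ≤ C`. [folklore] -/
theorem clampW_le {κ C : ℝ} (hκ : 0 ≤ κ) {f d : α → ℝ} (hf : ∀ a, f a ≤ C) (hC : 0 ≤ C) (a : α) : clampW κ f d a ≤ Real.sqrt (1 + C) := by
  unfold clampW
  refine Real.sqrt_le_sqrt (max_le ?_ ((min_le_right _ _).trans ((hf a).trans (by linarith))))
  nlinarith [mul_nonneg hκ (sq_nonneg (d a))]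

/-- `|clampW| ≤ √(1 + C)` under the same hypotheses. [folklore] -/
theorem abs_clampW_le {κ C : ℝ} (hκ : 0 ≤ κ) {f d : α → ℝ} (hf : ∀ a, f a ≤ C) (hC : 0 ≤ C) (a : α) : |clampW κ f d a| ≤ Real.sqrt (1 + C) := by
  rw [abs_of_nonneg (clampW_nonneg κ f d a)]; exact clampW_le hκ hf hC a

/-- The clamp is measurable when `f` and `d` are. [folklore] -/
theorem measurable_clampW [MeasurableSpace α] (κ : ℝ) {f d : α → ℝ} (hf : Measurable f) (hd : Measurable d) : Measurable (clampW κ f d) := by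
  unfold clampW
  exact Real.continuous_sqrt.measurable.comp ((measurable_const.sub ((hd.pow_const 2).const_mul κ)).max ((measurable_const.add ((hd.pow_const 2).const_mul κ)).min hf))

/-- **Invariance transfer**: if `f ∘ T = f` and `d ∘ T = d` pointwise then `clampW κ f d ∘ T = clampW κ f d`. [folklore] -/
theorem clampW_comp (κ : ℝ) {f d : α → ℝ} {T : α → α} (hf : ∀ a, f (T a) = f a) (hd : ∀ a, d (T a) = d a) (a : α) :
    clampW κ f d (T a) = clampW κ f d a := by
  unfold clampW; rw [hf, hd]

end Summit.QuantumFields.YangMills.Theorems.FemtoTransferGap.RateTube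

end
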